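import Mathlib
import Summits.Ventures.PercRepro.PuncturedLYMTypeLiftFamily
import Summits.Ventures.PercRepro.PuncturedLYMCoHypMain
import Summits.Ventures.PercRepro.PuncturedLYMTypeLiftFourTwelveRows
import Summits.Ventures.PercRepro.PuncturedLYMTypeLiftFourTwelveCols
import Summits.Ventures.PercRepro.PuncturedLYMTypeLiftFourTwelveMem

/-!
# PercRepro — (SP) FOR FOUR PAIRWISE DISJOINT 3-SETS AT LEVEL 4 ON 13 POINTS: THE THEOREM (p10, gen 39)

THE THEOREM `puncturedNMP_four_twelve`: (SP) at level `4` for four pairwise disjoint triples on `12` points — the type certificate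
of …FourTwelveTable / …Rows / …Cols through the type lift of PuncturedLYMTypeLift (general `k`; here `k = 4`) and gen 36's bridge.
-/

namespace PercRepro.PuncturedLYM.Split.TypeLift.FourTwelve

open Finset
/-! ### The checks in the `Fin 4 → ℕ` form used by the lift -/

/-- `a = ![a 0, a 1, a 2, a 3]`. -/
theorem eq_vec (a : Fin 4 → ℕ) : a = ![a 0, a 1, a 2, a 3] := by
  funext i; fin_cases i <;> rfl

/-- `Function.update a 0 v`. -/
theorem update_zero_eq (a : Fin 4 → ℕ) (v : ℕ) : Function.update a 0 v = ![v, a 1, a 2, a 3] := by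
  funext i; fin_cases i <;> simp

/-- `Function.update a 1 v`. -/
theorem update_one_eq (a : Fin 4 → ℕ) (v : ℕ) : Function.update a 1 v = ![a 0, v, a 2, a 3] := by
  funext i; fin_cases i <;> simp

/-- `Function.update a 2 v`. -/
theorem update_two_eq (a : Fin 4 → ℕ) (v : ℕ) : Function.update a 2 v = ![a 0, a 1, v, a 3] := by
  funext i; fin_cases i <;> simp

/-- `Function.update a 3 v`. -/
theorem update_three_eq (a : Fin 4 → ℕ) (v : ℕ) : Function.update a 3 v = ![a 0, a 1, a 2, v] := by
  funext i; fin_cases i <;> simp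

/-- The row equations for a row type given as a function. -/
theorem row_check' (a : Fin 4 → ℕ) (c : ℕ) (h₀ : a 0 ≤ 2) (h₁ : a 1 ≤ 2) (h₂ : a 2 ≤ 2) (h₃ : a 3 ≤ 2) (hc : c ≤ 0)
    (hs : a 0 + a 1 + a 2 + a 3 + c = 4) :
    ((3 - a 0 : ℕ) : ℚ) * W a c (some 0) + ((3 - a 1 : ℕ) : ℚ) * W a c (some 1) +
      ((3 - a 2 : ℕ) : ℚ) * W a c (some 2) + ((3 - a 3 : ℕ) : ℚ) * W a c (some 3) +
      ((0 - c : ℕ) : ℚ) * W a c none = 1 / 459 := by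
  have key := row_check (a 0) (a 1) (a 2) (a 3) c h₀ h₁ h₂ h₃ hc hs
  rw [← eq_vec a] at key
  exact key

/-- The free-column equations for a column type given as a function. -/
theorem col_free_check' (b : Fin 4 → ℕ) (c : ℕ) (h₀ : b 0 ≤ 2) (h₁ : b 1 ≤ 2) (h₂ : b 2 ≤ 2) (h₃ : b 3 ≤ 2)
    (hc : c ≤ 0) (hs : b 0 + b 1 + b 2 + b 3 + c = 5) :
    (b 0 : ℚ) * W (Function.update b 0 (b 0 - 1)) c (some 0) +
      (b 1 : ℚ) * W (Function.update b 1 (b 1 - 1)) c (some 1) +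
      (b 2 : ℚ) * W (Function.update b 2 (b 2 - 1)) c (some 2) +
      (b 3 : ℚ) * W (Function.update b 3 (b 3 - 1)) c (some 3) + (c : ℚ) * W b (c - 1) none = 1 / 792 := by
  have key := col_free_check (b 0) (b 1) (b 2) (b 3) c h₀ h₁ h₂ h₃ hc hs
  rw [← update_zero_eq, ← update_one_eq, ← update_two_eq, ← update_three_eq, ← eq_vec b] at key
  exact key

/-- The member-column equations for a column type given as a function. -/
theorem col_member_check' (b : Fin 4 → ℕ) (c : ℕ) (i₀ : Fin 4) (hi : b i₀ = 3) (hl : ∀ l, l ≠ i₀ → b l ≤ 2)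
    (hc : c ≤ 0) (hs : b 0 + b 1 + b 2 + b 3 + c = 5) :
    (3 : ℚ) * W (Function.update b i₀ (b i₀ - 1)) c (some i₀) = 1 / 792 := by
  fin_cases i₀
  · simp only [Fin.zero_eta, Fin.isValue] at hi hl ⊢
    rw [update_zero_eq, hi]
    exact col_member_check 2 (b 1) (b 2) (b 3) c 0 (by norm_num) (hl 1 (by decide)) (hl 2 (by decide))
      (hl 3 (by decide)) hc (by omega) (by simp)
  · simp only [Fin.mk_one, Fin.isValue] at hi hl ⊢
    rw [update_one_eq, hi]
    exact col_member_check (b 0) 2 (b 2) (b 3) c 1 (hl 0 (by decide)) (by norm_num) (hl 2 (by decide))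
      (hl 3 (by decide)) hc (by omega) (by simp)
  · simp only [Fin.reduceFinMk, Fin.isValue] at hi hl ⊢
    rw [update_two_eq, hi]
    exact col_member_check (b 0) (b 1) 2 (b 3) c 2 (hl 0 (by decide)) (hl 1 (by decide)) (by norm_num)
      (hl 3 (by decide)) hc (by omega) (by simp)
  · simp only [Fin.reduceFinMk, Fin.isValue] at hi hl ⊢
    rw [update_three_eq, hi]
    exact col_member_check (b 0) (b 1) (b 2) 2 c 3 (hl 0 (by decide)) (hl 1 (by decide)) (hl 2 (by decide))
      (by norm_num) hc (by omega) (by simp)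

/-! ### The theorem -/

section Main

variable {α : Type} [DecidableEq α] [Fintype α]

/-- Two of the members' up-levels are disjoint: a `4`-set contains at most one `3`-member. -/
theorem disjoint_upLevel_four (C : Fin 4 → Finset α) (hcard : ∀ i, (C i).card = 3)
    (hdisj : ∀ i l, i ≠ l → Disjoint (C i) (C l)) (i l : Fin 4) (hil : i ≠ l) :
    Disjoint (upLevel 4 (C i)) (upLevel 4 (C l)) := by
  rw [disjoint_left]
  intro X h1 h2
  rw [mem_upLevel] at h1 h2
  have := card_le_card (union_subset h1.2 h2.2)
  rw [card_union_of_disjoint (hdisj i l hil), hcard, hcard, h1.1] at this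
  omega

/-- `#P = C(12, 4) − 4·C(9, 1) = 459`. -/
theorem card_punctured_four_twelve (hn : Fintype.card α = 12) (C : Fin 4 → Finset α) (hcard : ∀ i, (C i).card = 3)
    (hdisj : ∀ i l, i ≠ l → Disjoint (C i) (C l)) :
    (punctured 4 ((univ : Finset (Fin 4)).biUnion (fun i => upLevel 4 (C i)))).card = 459 := by
  unfold punctured
  have hsub : (univ : Finset (Fin 4)).biUnion (fun i => upLevel 4 (C i)) ⊆ (univ : Finset α).powersetCard 4 := by
    intro X hX
    obtain ⟨i, _, hXi⟩ := mem_biUnion.1 hX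
    rw [mem_powersetCard]
    exact ⟨subset_univ X, (mem_upLevel.1 hXi).1⟩
  have hu : ∀ i, (upLevel 4 (C i)).card = 9 := by
    intro i
    rw [card_upLevel (by rw [hcard]; norm_num), hcard, hn]
    rfl
  rw [card_sdiff_of_subset hsub, card_powersetCard, card_univ, hn,
    card_biUnion (fun i _ l _ hil => disjoint_upLevel_four C hcard hdisj i l hil)]
  simp only [hu, sum_const, card_univ, Fintype.card_fin, smul_eq_mul]
  rfl

omit [DecidableEq α] in
/-- `#Y = C(12, 5) = 792`. -/
theorem card_levelAbove_four_twelve (hn : Fintype.card α = 12) : (levelAbove α 4).card = 792 := by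
  unfold levelAbove
  rw [card_powersetCard, card_univ, hn]
  rfl

/-- **THEOREM. (SP) for four pairwise disjoint `3`-sets at level `4` on `12` points** (the open mixed-size class), by
the type certificate. -/
theorem puncturedNMP_four_twelve (hn : Fintype.card α = 12) (C : Fin 4 → Finset α)
    (hcard : ∀ i, (C i).card = 3) (hdisj : ∀ i l, i ≠ l → Disjoint (C i) (C l)) :
    PuncturedNMP 4 ((univ : Finset (Fin 4)).biUnion (fun i => upLevel 4 (C i))) := by
  apply puncturedNMP_of_hasFlow
  rw [card_punctured_four_twelve hn C hcard hdisj, card_levelAbove_four_twelve hn]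
  have hbig : ∀ i l, i ≠ l → 4 + 2 ≤ (C i).card + (C l).card := by
    intro i l _
    rw [hcard, hcard]
  have hfree : (freeSet C).card = 0 := by
    rw [card_freeSet hdisj, hn]
    simp [hcard]
  refine hasFlow_of_typeWeights C (fun X hX => card_eq_of_mem_punctured_family hX) _ _ W
    (fun a c d => W_nonneg a c d) ?_ ?_
  · -- the rows
    intro X hX
    have hX' := mem_punctured_family.1 hX
    have h0 := typ_lt_card_of_not_subset C (hX'.2 0)
    have h1 := typ_lt_card_of_not_subset C (hX'.2 1)
    have h2 := typ_lt_card_of_not_subset C (hX'.2 2)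
    have h3 := typ_lt_card_of_not_subset C (hX'.2 3)
    rw [hcard] at h0 h1 h2 h3
    have hc := fc_le_card C X
    rw [hfree] at hc
    have hs := sum_typ_add_fc hdisj X
    rw [Fin.sum_univ_four, hX'.1] at hs
    rw [rowSum_eq, Fin.sum_univ_four, card_sdiff_eq_sub_typ, card_sdiff_eq_sub_typ, card_sdiff_eq_sub_typ,
      card_sdiff_eq_sub_typ, card_freeSet_sdiff, hcard, hcard, hcard, hcard, hfree]
    exact row_check' (typ C X) (fc C X) (by omega) (by omega) (by omega) (by omega) hc hs
  · -- the columns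
    intro Y hY
    have hYc : Y.card = 4 + 1 := (mem_cols.1 hY).2
    have hc := fc_le_card C Y
    rw [hfree] at hc
    have hs := sum_typ_add_fc hdisj Y
    rw [Fin.sum_univ_four, hYc] at hs
    by_cases hmem : ∃ i₀, C i₀ ⊆ Y
    · obtain ⟨i₀, hi₀⟩ := hmem
      rw [colSum_eq_of_member W hdisj hbig hYc hi₀, hcard]
      have hi : typ C Y i₀ = 3 := by rw [typ_eq_card_of_subset C hi₀, hcard]
      have hl : ∀ l, l ≠ i₀ → typ C Y l ≤ 2 := by
        intro l hl
        have hnot : ¬ C l ⊆ Y := by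
          intro hCl
          have := card_le_card (union_subset hCl hi₀)
          rw [card_union_of_disjoint (hdisj l i₀ hl), hcard, hcard, hYc] at this
          omega
        have := typ_lt_card_of_not_subset C hnot
        rw [hcard] at this
        omega
      exact col_member_check' (typ C Y) (fc C Y) i₀ hi hl hc hs
    · have hmem' : ∀ i, ¬ C i ⊆ Y := fun i h => hmem ⟨i, h⟩
      rw [colSum_eq_of_free W hdisj hYc hmem', Fin.sum_univ_four]
      have h0 := typ_lt_card_of_not_subset C (hmem' 0)
      have h1 := typ_lt_card_of_not_subset C (hmem' 1)
      have h2 := typ_lt_card_of_not_subset C (hmem' 2)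
      have h3 := typ_lt_card_of_not_subset C (hmem' 3)
      rw [hcard] at h0 h1 h2 h3
      exact col_free_check' (typ C Y) (fc C Y) (by omega) (by omega) (by omega) (by omega) hc hs

end Main

end PercRepro.PuncturedLYM.Split.TypeLift.FourTwelve
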